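import Summits.HubbardSuperconductivity.HubbardSuperconductivity.Theorems.BalabanIRBirComplexStableXYRCoreEnvelope
import Summits.HubbardSuperconductivity.HubbardSuperconductivity.Theorems.BalabanIRBirComplexStableXYFixedVolumeCoercive
import Summits.HubbardSuperconductivity.HubbardSuperconductivity.Theorems.BalabanIRBirComplexStableXYReality
import Summits.HubbardSuperconductivity.HubbardSuperconductivity.Theorems.BalabanIRBirComplexStableXYRJensenTransfer
import Summits.HubbardSuperconductivity.HubbardSuperconductivity.Theorems.BalabanIRBirComplexStableXYRPositivityCore
import HarnessLib

/-!
# Crux `BirComplexStableXYR` (stmt-HubbardSuperconductivity-14845), line `log-concave-core-bounded-phase`: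
# the large-field TILT bound reduces to TILTED LOCAL EQUIPARTITION (checked reduction, stub itself open)

Work file of stub `stub_largeFieldTilt` (planner P2).  The registered stub asserts, for the positive modulus
measure `e^{-Re A} dθ = e^{-K Σ_s Re F_s} dθ` on the cube, that tilting by half the coercive energy of the
windows of `S` costs at most `C₁^{|S|}` uniformly in `K ≥ K₁(r,B,c₀)`, the volume and `S`:
`∫ e^{(K/2)Σ_{s∈S} Re F_s} e^{-Re A} ≤ C₁^{|S|} ∫ e^{-Re A}`, i.e. `Z_{K/2 on S, K off S} ≤ C₁^{|S|} Z_K`.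

VERDICT of the worker (2026-08-16): TRUE in every regime probed (fixed volume: Laplace sandwich; `S = Λ`:
the lead's global free-energy bound; quasi-1D tori; single window vs. long lines: Gaussian determinant ratio
`det(1 - H^{-1/2} H_S H^{-1/2}/2)^{-1/2} ≤ 2^{r³|S|/2}`), but its volume-uniform proof IS the local
large-field estimate of a Balaban-type renormalisation group (no reflection positivity for general complex
tables, no Ginibre inequality since `Re F` need not be ferromagnetic, no FKG), hence `stub-blocked`.

What this file proves (rc 0, no sorry): the tilt bound follows from ONE missing estimate, *tilted local
equipartition* — under the half-tilted modulus measure `e^{(K/2)Σ_{s∈S} Re F_s} e^{-Re A} dθ` every tilted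
window has expected coercive energy `≤ C₃/K`:

  `∀ s ∈ S, ∫ Re F_s · w_S ≤ (C₃/K) ∫ w_S`,  `w_S := e^{(K/2)Σ_{s∈S} Re F_s} e^{-Re A}`

(the inhomogeneous twin of the lead's `stub_uniformEquipartition`, which is the case `S = ∅`/translation
average).  The reduction is Jensen for `exp` under the probability density `w_S/∫w_S` (tangent-line form,
tree lemma `jensen_exp_weighted`): `Z/Z_S = E_S[e^{-(K/2)Σ_S Re F_s}] ≥ exp(-(K/2)Σ_{s∈S} E_S[Re F_s])
≥ e^{-|S| C₃/2}`, so `C₁ = e^{max(C₃,0)/2}`.  [folklore]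
-/

noncomputable section

namespace Summit.HubbardSuperconductivity.HubbardSuperconductivity.Theorems

open scoped BigOperators
open MeasureTheory Literature.Probability.LatticeModels
open Summit.HubbardSuperconductivity.BirComplexStableXYNegative

section LargeFieldTilt

variable {r : ℕ}

/-- **Abstract tilt-from-equipartition (Jensen).**  For a weight `w₀ ≥ 0` and a real tilt `X` with
`w := e^{X} w₀` integrable, `X w` integrable, `∫ w > 0` and the "equipartition" bound `∫ X w ≤ m ∫ w`,
the tilted mass is at most `e^{m}` times the untilted one: `∫ e^{X} w₀ ≤ e^{m} ∫ w₀`. [folklore] -/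
theorem lft_tilt_of_mean_bound {α : Type*} [MeasurableSpace α] (μ : Measure α) (w₀ X : α → ℝ) (m : ℝ)
    (hw₀ : ∀ a, 0 ≤ w₀ a) (hw₀i : Integrable w₀ μ)
    (hwi : Integrable (fun a => Real.exp (X a) * w₀ a) μ)
    (hXw : Integrable (fun a => X a * (Real.exp (X a) * w₀ a)) μ)
    (hpos : 0 < ∫ a, Real.exp (X a) * w₀ a ∂μ)
    (hm : ∫ a, X a * (Real.exp (X a) * w₀ a) ∂μ ≤ m * ∫ a, Real.exp (X a) * w₀ a ∂μ) :
    ∫ a, Real.exp (X a) * w₀ a ∂μ ≤ Real.exp m * ∫ a, w₀ a ∂μ := by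
  set w : α → ℝ := fun a => Real.exp (X a) * w₀ a with hw
  have hwnn : ∀ a, 0 ≤ w a := fun a => mul_nonneg (Real.exp_pos _).le (hw₀ a)
  have hfw : Integrable (fun a => (-X a) * w a) μ := by
    have h := hXw.neg
    refine h.congr (ae_of_all _ fun a => ?_)
    simp only [Pi.neg_apply, neg_mul, hw]
  have hback : (fun a => Real.exp (-X a) * w a) = w₀ := by
    funext a
    simp only [hw]
    rw [← mul_assoc, ← Real.exp_add, neg_add_cancel, Real.exp_zero, one_mul]
  have hefw : Integrable (fun a => Real.exp (-X a) * w a) μ := by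
    rw [hback]; exact hw₀i
  have J := jensen_exp_weighted μ w (fun a => -X a) hwnn hwi hfw hefw hpos
  rw [hback] at J
  have hI : ∫ a, (-X a) * w a ∂μ = -∫ a, X a * w a ∂μ := by
    rw [← integral_neg]
    refine integral_congr_ae (ae_of_all _ fun a => ?_)
    simp only [neg_mul]
  have hge : -m ≤ (∫ a, (-X a) * w a ∂μ) / ∫ a, w a ∂μ := by
    rw [hI, le_div_iff₀ hpos]
    have : ∫ a, X a * w a ∂μ ≤ m * ∫ a, w a ∂μ := hm
    linarith
  have h1 : Real.exp (-m) ≤ (∫ a, w₀ a ∂μ) / ∫ a, w a ∂μ := (Real.exp_le_exp.2 hge).trans J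
  rw [le_div_iff₀ hpos] at h1
  have hexp : Real.exp m * Real.exp (-m) = 1 := by
    rw [← Real.exp_add, add_neg_cancel, Real.exp_zero]
  calc ∫ a, w a ∂μ = Real.exp m * (Real.exp (-m) * ∫ a, w a ∂μ) := by
        rw [← mul_assoc, hexp, one_mul]
    _ ≤ Real.exp m * ∫ a, w₀ a ∂μ := mul_le_mul_of_nonneg_left h1 (Real.exp_pos m).le

/-- Real part of the action: `Re A(θ) = K Σ_s Re F_s(θ)`. [folklore] -/
theorem lft_action_re (K : ℝ) (c : Table r) (L M : ℕ) [NeZero L] [NeZero M] (θ : Λ L M → ℝ) :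
    (action K c L M θ).re = K * ∑ s : Λ L M, (genF c (fun w => θ (sh L M s w))).re := by
  simp [action, Complex.mul_re, Complex.re_sum]

/-- The action is continuous in the torus field. [folklore] -/
theorem lft_continuous_action (K : ℝ) (c : Table r) (L M : ℕ) [NeZero L] [NeZero M] :
    Continuous fun θ : Λ L M → ℝ => action K c L M θ := by
  unfold action
  fun_prop

/-- Continuous functions are integrable on the (compact) cube. [folklore] -/
theorem lft_integrable_cube {L M : ℕ} [NeZero L] [NeZero M] {f : (Λ L M → ℝ) → ℝ}
    (hf : Continuous f) :
    Integrable f (volume.restrict (cube L M)) :=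
  hf.continuousOn.integrableOn_compact (isCompact_univ_pi fun _ => isCompact_Icc)

/-- A positive continuous function has positive integral over the cube. [folklore] -/
theorem lft_setIntegral_cube_pos {L M : ℕ} [NeZero L] [NeZero M] {f : (Λ L M → ℝ) → ℝ}
    (hf : Continuous f) (hpos : ∀ θ, 0 < f θ) : 0 < ∫ θ in cube L M, f θ := by
  rw [setIntegral_pos_iff_support_of_nonneg_ae (Filter.Eventually.of_forall fun θ => (hpos θ).le)
    (lft_integrable_cube hf)]
  have hsupp : Function.support f = Set.univ := Set.eq_univ_of_forall fun θ => (hpos θ).ne'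
  rw [hsupp, Set.univ_inter]
  exact volume_birCube_pos L M

/-- **The large-field tilt bound from tilted local equipartition** (checked reduction of stub
`stub_largeFieldTilt`).  If under every half-tilted modulus measure `w_S = e^{(K/2)Σ_{s∈S} Re F_s} e^{-Re A}`
each tilted window has expected coercive energy `≤ C₃/K` (uniformly in `K ≥ K₁(r,B,c₀)`, admissible tables,
the volume and `S`), then `∫ w_S ≤ C₁^{|S|} ∫ e^{-Re A}` with `C₁ = e^{max(C₃,0)/2}` — the registered
signature of `stub_largeFieldTilt` verbatim as conclusion. [folklore] -/
theorem largeFieldTilt_of_tiltedEquipartition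
    (hLE : ∀ (r : ℕ) (B c₀ : ℝ), 2 ≤ r → 0 < c₀ → ∃ K₁ C₃ : ℝ, ∀ K : ℝ, K₁ ≤ K → ∀ c : Table r,
      (∀ n ∈ c.support, ∑ w, n w = 0) → c.sum (fun _ a => a) = 0 → normA c ≤ B →
      (∀ φ : W r → ℝ, c₀ * ∑ w, ∑ w', (1 - Real.cos (φ w - φ w')) ≤ (genF c φ).re) →
      ∀ (L M : ℕ) [NeZero L] [NeZero M], ∀ S : Finset (Λ L M), ∀ s ∈ S,
      ∫ θ in cube L M, (genF c (fun w => θ (sh L M s w))).re *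
          (Real.exp (K / 2 * ∑ s ∈ S, (genF c (fun w => θ (sh L M s w))).re) *
            Real.exp (-(action K c L M θ).re)) ≤
        C₃ / K * ∫ θ in cube L M, Real.exp (K / 2 * ∑ s ∈ S, (genF c (fun w => θ (sh L M s w))).re) *
            Real.exp (-(action K c L M θ).re)) :
    ∀ (r : ℕ) (B c₀ : ℝ), 2 ≤ r → 0 < c₀ → ∃ K₁ C₁ : ℝ, 0 < C₁ ∧ ∀ K : ℝ, K₁ ≤ K → ∀ c : Table r, (∀ n ∈ c.support, ∑ w, n w = 0) → c.sum (fun _ a => a) = 0 → normA c ≤ B → (∀ φ : W r → ℝ, c₀ * ∑ w, ∑ w', (1 - Real.cos (φ w - φ w')) ≤ (genF c φ).re) → ∀ (L M : ℕ) [NeZero L] [NeZero M], ∀ S : Finset (Λ L M), ∫ θ in cube L M, Real.exp (K / 2 * ∑ s ∈ S, (genF c (fun w => θ (sh L M s w))).re) * Real.exp (-(action K c L M θ).re) ≤ C₁ ^ S.card * ∫ θ in cube L M, Real.exp (-(action K c L M θ).re) := by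
  intro r B c₀ hr hc₀
  obtain ⟨K₁, C₃, H⟩ := hLE r B c₀ hr hc₀
  refine ⟨max K₁ 1, Real.exp (max C₃ 0 / 2), Real.exp_pos _, ?_⟩
  intro K hK c hU1 hN hA hC L M _ _ S
  have hK₁ : K₁ ≤ K := le_trans (le_max_left _ _) hK
  have hK0 : 0 < K := lt_of_lt_of_le one_pos (le_trans (le_max_right _ _) hK)
  have HS := H K hK₁ c hU1 hN hA hC L M S
  -- the three players: tilt `X`, base weight `w₀`, tilted weight `e^X w₀`
  have hXc : Continuous fun θ : Λ L M → ℝ =>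
      K / 2 * ∑ s ∈ S, (genF c (fun w => θ (sh L M s w))).re := by
    fun_prop
  have hw₀c : Continuous fun θ : Λ L M → ℝ => Real.exp (-(action K c L M θ).re) :=
    Real.continuous_exp.comp (Complex.continuous_re.comp (lft_continuous_action K c L M)).neg
  have hwc : Continuous fun θ : Λ L M → ℝ =>
      Real.exp (K / 2 * ∑ s ∈ S, (genF c (fun w => θ (sh L M s w))).re) *
        Real.exp (-(action K c L M θ).re) :=
    (Real.continuous_exp.comp hXc).mul hw₀c
  have hFc : ∀ s : Λ L M, Continuous fun θ : Λ L M → ℝ => (genF c (fun w => θ (sh L M s w))).re := by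
    intro s; fun_prop
  have hpos : 0 < ∫ θ in cube L M, Real.exp (K / 2 * ∑ s ∈ S, (genF c (fun w => θ (sh L M s w))).re) *
      Real.exp (-(action K c L M θ).re) :=
    lft_setIntegral_cube_pos hwc fun θ => mul_pos (Real.exp_pos _) (Real.exp_pos _)
  -- the mean bound `∫ X w ≤ (|S| max(C₃,0)/2) ∫ w`
  have hmean : ∫ θ in cube L M, (K / 2 * ∑ s ∈ S, (genF c (fun w => θ (sh L M s w))).re) *
      (Real.exp (K / 2 * ∑ s ∈ S, (genF c (fun w => θ (sh L M s w))).re) *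
        Real.exp (-(action K c L M θ).re)) ≤
      (S.card : ℝ) * (max C₃ 0 / 2) * ∫ θ in cube L M,
        Real.exp (K / 2 * ∑ s ∈ S, (genF c (fun w => θ (sh L M s w))).re) *
          Real.exp (-(action K c L M θ).re) := by
    set wS : (Λ L M → ℝ) → ℝ := fun θ =>
      Real.exp (K / 2 * ∑ s ∈ S, (genF c (fun w => θ (sh L M s w))).re) *
        Real.exp (-(action K c L M θ).re) with hwS
    have hint : ∀ s : Λ L M, Integrable (fun θ => (genF c (fun w => θ (sh L M s w))).re * wS θ)
        (volume.restrict (cube L M)) := fun s => lft_integrable_cube ((hFc s).mul hwc)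
    have hsplit : (fun θ : Λ L M → ℝ => (K / 2 * ∑ s ∈ S, (genF c (fun w => θ (sh L M s w))).re) * wS θ)
        = fun θ => K / 2 * ∑ s ∈ S, (genF c (fun w => θ (sh L M s w))).re * wS θ := by
      funext θ
      rw [mul_assoc, Finset.sum_mul]
    rw [hsplit, integral_const_mul, integral_finsetSum _ (fun s _ => hint s)]
    have hsum : ∑ s ∈ S, ∫ θ in cube L M, (genF c (fun w => θ (sh L M s w))).re * wS θ ≤
        ∑ _s ∈ S, C₃ / K * ∫ θ in cube L M, wS θ :=
      Finset.sum_le_sum fun s hs => HS s hs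
    rw [Finset.sum_const, nsmul_eq_mul] at hsum
    have hZnn : 0 ≤ ∫ θ in cube L M, wS θ := hpos.le
    have hC3 : C₃ ≤ max C₃ 0 := le_max_left _ _
    calc K / 2 * ∑ s ∈ S, ∫ θ in cube L M, (genF c (fun w => θ (sh L M s w))).re * wS θ
        ≤ K / 2 * ((S.card : ℝ) * (C₃ / K * ∫ θ in cube L M, wS θ)) :=
          mul_le_mul_of_nonneg_left hsum (by positivity)
      _ = (S.card : ℝ) * (C₃ / 2) * ∫ θ in cube L M, wS θ := by
          field_simp
      _ ≤ (S.card : ℝ) * (max C₃ 0 / 2) * ∫ θ in cube L M, wS θ := by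
          gcongr
  -- Jensen
  have key := lft_tilt_of_mean_bound (volume.restrict (cube L M))
    (fun θ => Real.exp (-(action K c L M θ).re))
    (fun θ => K / 2 * ∑ s ∈ S, (genF c (fun w => θ (sh L M s w))).re)
    ((S.card : ℝ) * (max C₃ 0 / 2)) (fun θ => (Real.exp_pos _).le) (lft_integrable_cube hw₀c)
    (lft_integrable_cube hwc) (lft_integrable_cube (hXc.mul hwc)) hpos hmean
  rw [Real.exp_nat_mul] at key
  exact key

end LargeFieldTilt


/-- **Registered binder-free form**: tilted local equipartition ⇒ the large-field tilt bound
`stub_largeFieldTilt`. [folklore] -/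
theorem largeFieldTilt_of_tiltedEquipartition' :
    (∀ (r : ℕ) (B c₀ : ℝ), 2 ≤ r → 0 < c₀ → ∃ K₁ C₃ : ℝ, ∀ K : ℝ, K₁ ≤ K → ∀ c : Table r, (∀ n ∈ c.support, ∑ w, n w = 0) → c.sum (fun _ a => a) = 0 → normA c ≤ B → (∀ φ : W r → ℝ, c₀ * ∑ w, ∑ w', (1 - Real.cos (φ w - φ w')) ≤ (genF c φ).re) → ∀ (L M : ℕ) [NeZero L] [NeZero M], ∀ S : Finset (Λ L M), ∀ s ∈ S, ∫ θ in cube L M, (genF c (fun w => θ (sh L M s w))).re * (Real.exp (K / 2 * ∑ s ∈ S, (genF c (fun w => θ (sh L M s w))).re) * Real.exp (-(action K c L M θ).re)) ≤ C₃ / K * ∫ θ in cube L M, Real.exp (K / 2 * ∑ s ∈ S, (genF c (fun w => θ (sh L M s w))).re) * Real.exp (-(action K c L M θ).re)) → (∀ (r : ℕ) (B c₀ : ℝ), 2 ≤ r → 0 < c₀ → ∃ K₁ C₁ : ℝ, 0 < C₁ ∧ ∀ K : ℝ, K₁ ≤ K → ∀ c : Table r, (∀ n ∈ c.support, ∑ w,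 n w = 0) → c.sum (fun _ a => a) = 0 → normA c ≤ B → (∀ φ : W r → ℝ, c₀ * ∑ w, ∑ w', (1 - Real.cos (φ w - φ w')) ≤ (genF c φ).re) → ∀ (L M : ℕ) [NeZero L] [NeZero M], ∀ S : Finset (Λ L M), ∫ θ in cube L M, Real.exp (K / 2 * ∑ s ∈ S, (genF c (fun w => θ (sh L M s w))).re) * Real.exp (-(action K c L M θ).re) ≤ C₁ ^ S.card * ∫ θ in cube L M, Real.exp (-(action K c L M θ).re)) :=
  fun hLE => largeFieldTilt_of_tiltedEquipartition hLE

end Summit.HubbardSuperconductivity.HubbardSuperconductivity.Theorems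

end
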